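import Summits.QuantumFields.GaugeBoot.TiltedLinkRPCrossing
import HarnessLib

/-!
# Link (mid-plane) reflection positivity of the Wilson measure of a periodic lattice (gauge-boot, L3(υ) part 5)

HONEST FRAMING (cell `pub-gaugeboot`, page 1 of every file): the venture produces certified bounds
on lattice expectations at stated coupling, gauge group, dimension and torus size; NOT a mass gap,
NOT a continuum limit, NOT a string tension; NOT Yang–Mills-summit-bearing (barriers
`FixedCouplingUltralocality`, `PerturbativeInvisibility`).

Main result of the L3(υ) chain (`TiltedLinkRPGeometry/Plaquettes/Holonomy/Crossing.lean`):

* `IsSiteFrame.linkRP_integral_conj_mul_nonneg` — **mid-plane (link) reflection positivity.** For a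
  periodic lattice `(A, e)` with a site frame `IsSiteFrame e k σ Q h` (`TiltedSiteRPGeometry.lean`),
  a compact second countable gauge group `G`, a continuous representation `ρ`, `β ≥ 0` and every
  bounded measurable `F` depending only on the links with both endpoints in the closed half
  `{1 ≤ h ≤ Q}` (`IsMidObservable`):
  `0 ≤ ∫ conj F(ΘU) · F(U) dμ_β(U)`, where `Θ = configMidReflect e k σ` is the Osterwalder–Seiler
  reflection in the hyperplane `h = ½` (`k`-links crossing the hyperplanes `h = ½`, `h = Q + ½`
  reversed and inverted) and `μ_β = gibbs ρ e β` the Wilson probability measure;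
* `IsSiteFrame.linkRP_sum_mul_conj_integral_nonneq`-type corollary
  `IsSiteFrame.linkRP_sum_mul_conj_integral_nonneg`: the link RP blocks
  `(⟨conj(F_a ∘ Θ) F_b⟩_β)_{ab}` are positive semidefinite — the form consumed by a reflection-
  positivity block of a lattice bootstrap SDP (Kazakov–Zheng's second RP family);
* `IsSiteFrame.integral_comp_configMidReflect_gibbs`: `μ_β` is `Θ`-invariant (every real `β`).

Proof (Osterwalder–Seiler 1978 §2, as ported from the cubic torus in
`Literature.MathematicalPhysics.QuantumFieldTheory.ConstructiveQFTWave0Proofs`; no gauge fixing):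
`S = N·#plaquettes - A - A∘Θ - X` (`TiltedLinkRPHolonomy.sum_plaqObs_split_mid`); the substitution
`midTranslate Y` (measure preserving for each `Y`) splits the crossing link variables, after which
`X` is the Gram kernel `∑_ι a_ι(z) conj a_ι(ΘU)`, `z = splice_C(U, Y)`
(`TiltedLinkRPCrossing.sum_midCoeff_mul_conj`); the pointwise identity
`midIntegrand_midTranslate` and the abstract mechanism
`Literature.MathematicalPhysics.QuantumFieldTheory.LatticeRP.integral_mul_conj_mul_exp_nonneg`
(blocks `P` = positive links, `C` = crossing links; `Θ` preserves `∏ dU` and reads the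
`P ∪ C`-coordinates of `ΘU` off links outside `P`) finish the proof.

References: K. Osterwalder, E. Seiler, Ann. Phys. 110 (1978) 440, §2; E. Seiler, LNP 159 (1982);
V. Kazakov, Z. Zheng, arXiv:2203.11360 §3.1 (second RP family of the bootstrap).
-/

noncomputable section

open MeasureTheory Complex
open scoped ComplexOrder ComplexConjugate
open Literature.MathematicalPhysics.QuantumFieldTheory (haarProbability LatticeRP.splice
  LatticeRP.splice_apply LatticeRP.measurable_splice LatticeRP.integral_mul_conj_mul_exp_nonneg
  LatticeRP.integral_comp_eq_of_measurePreserving)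
open Literature.RepresentationTheory.CompactGroups

namespace Summit.QuantumFields.GaugeBoot

namespace TiltedRP

namespace IsSiteFrame

variable {A : Type*} [AddCommGroup A] [Fintype A] {d : ℕ}
variable {e : Fin d → A} {k : Fin d} {σ : A →+ A} {Q : ℕ} {h : A →+ ZMod (2 * Q)}
variable (hF : IsSiteFrame e k σ Q h)
variable {N : ℕ} {G : Type*} [Group G] [TopologicalSpace G] [IsTopologicalGroup G] [CompactSpace G]
  [MeasurableSpace G] [BorelSpace G] [SecondCountableTopology G]
variable (ρ : G →* Matrix (Fin N) (Fin N) ℂ)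
include hF

/-! ## The blocks: agreement on `P ∪ C`, the hypothesis `hΘdep` -/

omit [Group G] [TopologicalSpace G] [IsTopologicalGroup G] [CompactSpace G] [MeasurableSpace G]
  [BorelSpace G] [SecondCountableTopology G] hF in
/-- Two configurations agreeing on the blocks `P ∪ C` agree on every positive or crossing link. -/
theorem eq_on_of_eq_on_midBlocks [DecidableEq A] {U V : Config A d G}
    (hUV : ∀ l ∈ ((midPosBlock e Q h ∪ midCrossBlock k Q h : Finset (Link A d)) : Set (Link A d)),
      U l = V l) :
    ∀ l, IsMidPosLink e Q h l ∨ IsMidCrossLink k Q h l → U l = V l := by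
  intro l hl
  apply hUV
  rw [Finset.coe_union, Set.mem_union, Finset.mem_coe, Finset.mem_coe, mem_midPosBlock,
    mem_midCrossBlock]
  exact hl

omit [TopologicalSpace G] [IsTopologicalGroup G] [CompactSpace G] [MeasurableSpace G] [BorelSpace G]
  [SecondCountableTopology G] in
/-- **Hypothesis `hΘdep` of the mechanism**: the reflected value of a positive or crossing link is
read off a link outside the positive block. -/
theorem dependsOn_configMidReflect_apply [DecidableEq A] (l : Link A d)
    (hl : l ∈ midPosBlock e Q h ∪ midCrossBlock k Q h) :
    DependsOn (fun U : Config A d G => configMidReflect e k σ U l)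
      (((midPosBlock e Q h)ᶜ : Finset (Link A d)) : Set (Link A d)) := by
  intro U V hUV
  have hl' : IsMidPosLink e Q h l ∨ IsMidCrossLink k Q h l := by
    rcases Finset.mem_union.1 hl with h1 | h1
    · exact Or.inl (mem_midPosBlock.1 h1)
    · exact Or.inr (mem_midCrossBlock.1 h1)
  have hout : midLinkMap e k σ l ∈ (((midPosBlock e Q h)ᶜ : Finset (Link A d)) : Set (Link A d)) := by
    rw [Finset.coe_compl, Set.mem_compl_iff, Finset.mem_coe, mem_midPosBlock]
    exact hF.not_isMidPosLink_midLinkMap hl'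
  have hval := hUV _ hout
  simp only [configMidReflect, hval]

/-! ## The positive part of the action and the observable `g` -/

open scoped Classical in
omit [TopologicalSpace G] [IsTopologicalGroup G] [CompactSpace G] [MeasurableSpace G] [BorelSpace G]
  [SecondCountableTopology G] in
/-- The positive part `A(U)` of the plaquette sum depends only on the positive links. -/
theorem sum_pos_congr {U V : Config A d G} (hUV : ∀ l, IsMidPosLink e Q h l → U l = V l) :
    ∑ p ∈ Finset.univ.filter (IsMidPosPlaq k Q h), plaqObs ρ e p U =
      ∑ p ∈ Finset.univ.filter (IsMidPosPlaq k Q h), plaqObs ρ e p V :=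
  Finset.sum_congr rfl fun p hp => by
    obtain ⟨h1, h2, h3, h4⟩ := hF.isMidPosLink_of_isMidPosPlaq (Finset.mem_filter.1 hp).2
    exact IsTiltedFrame.plaqObs_congr ρ p (hUV _ h1) (hUV _ h2) (hUV _ h3) (hUV _ h4)

open scoped Classical in
omit hF in
/-- The observable `g = F · exp(β A)` (half-space observable times the positive part of the
Boltzmann weight). -/
def midGObs (e : Fin d → A) (k : Fin d) (Q : ℕ) (h : A →+ ZMod (2 * Q)) (β : ℝ)
    (F : Config A d G → ℂ) (V : Config A d G) : ℂ :=
  F V * (Real.exp (β * ∑ p ∈ Finset.univ.filter (IsMidPosPlaq k Q h), plaqObs ρ e p V) : ℂ)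

open scoped Classical in
omit [CompactSpace G] hF in
/-- `g` is measurable. -/
theorem measurable_midGObs (hρ : Continuous ρ) (β : ℝ) {F : Config A d G → ℂ} (hFm : Measurable F) :
    Measurable (midGObs ρ e k Q h β F) := by
  unfold midGObs
  refine hFm.mul (Complex.measurable_ofReal.comp (Measurable.exp (Measurable.const_mul ?_ β)))
  exact (continuous_finsetSum _ fun p _ => continuous_plaqObs ρ hρ e p).measurable

open scoped Classical in
omit [MeasurableSpace G] [BorelSpace G] [SecondCountableTopology G] hF in
/-- `g` is bounded: `‖g‖ ≤ |C_F| e^{β N #plaquettes}`. -/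
theorem norm_midGObs_le (hρ : Continuous ρ) {β : ℝ} (hβ : 0 ≤ β) {F : Config A d G → ℂ} {CF : ℝ}
    (hFb : ∀ U, ‖F U‖ ≤ CF) (V : Config A d G) :
    ‖midGObs ρ e k Q h β F V‖ ≤ |CF| * Real.exp (β * (N * Fintype.card (Plaq A d))) := by
  rw [midGObs, norm_mul, Complex.norm_real, Real.norm_eq_abs, abs_of_pos (Real.exp_pos _)]
  refine mul_le_mul ((hFb V).trans (le_abs_self _)) ?_ (Real.exp_pos _).le (abs_nonneg _)
  refine Real.exp_le_exp.2 (mul_le_mul_of_nonneg_left ?_ hβ)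
  have h1 := abs_sum_plaqObs_le ρ hρ e (Finset.univ.filter (IsMidPosPlaq k Q h)) V
  have c1 : ((Finset.univ.filter (IsMidPosPlaq k Q h)).card : ℝ) ≤ Fintype.card (Plaq A d) := by
    exact_mod_cast Finset.card_filter_le _ _
  have hN : (0 : ℝ) ≤ N := Nat.cast_nonneg _
  rw [abs_le] at h1
  nlinarith

open scoped Classical in
omit [TopologicalSpace G] [IsTopologicalGroup G] [CompactSpace G] [MeasurableSpace G] [BorelSpace G]
  [SecondCountableTopology G] in
/-- `g` depends only on the positive links (stated for agreement on positive or crossing links). -/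
theorem midGObs_congr (β : ℝ) {F : Config A d G → ℂ} (hFo : IsMidObservable e Q h F)
    {U V : Config A d G} (hUV : ∀ l, IsMidPosLink e Q h l ∨ IsMidCrossLink k Q h l → U l = V l) :
    midGObs ρ e k Q h β F U = midGObs ρ e k Q h β F V := by
  have hP : ∀ l, IsMidPosLink e Q h l → U l = V l := fun l hl => hUV l (Or.inl hl)
  simp only [midGObs, hFo U V hP, hF.sum_pos_congr ρ hP]

/-! ## The integrands and the pointwise identity -/

/-- The integrand `exp(-β S(U)) conj F(ΘU) F(U)` of `⟨conj(F ∘ Θ) F⟩` against the product Haar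
measure. -/
def midIntegrand (e : Fin d → A) (k : Fin d) (σ : A →+ A) (β : ℝ) (F : Config A d G → ℂ)
    (U : Config A d G) : ℂ :=
  (Real.exp (-β * wilsonAction ρ e U) : ℂ) * (conj (F (configMidReflect e k σ U)) * F U)

open scoped Classical in
omit hF in
/-- The doubled integrand `R(U, Y) = e^{-βN#plaq} g(z) conj g(ΘU) exp(∑_ι a_ι(z) conj a_ι(ΘU))`,
`z = splice_C(U, Y)`. -/
def midIntegrand₂ (e : Fin d → A) (k : Fin d) (σ : A →+ A) (Q : ℕ) (h : A →+ ZMod (2 * Q))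
    (hρ : Continuous ρ) (β : ℝ) (F : Config A d G → ℂ) (p : Config A d G × Config A d G) : ℂ :=
  (Real.exp (-β * (N * Fintype.card (Plaq A d))) : ℂ) *
    (midGObs ρ e k Q h β F (LatticeRP.splice (midCrossBlock k Q h) p) *
        conj (midGObs ρ e k Q h β F (configMidReflect e k σ p.1)) *
      Complex.exp (∑ ι, midCoeff ρ e k Q h hρ β ι (LatticeRP.splice (midCrossBlock k Q h) p) *
        conj (midCoeff ρ e k Q h hρ β ι (configMidReflect e k σ p.1))))

open scoped Classical in
omit [MeasurableSpace G] [BorelSpace G] [SecondCountableTopology G] in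
/-- **The pointwise identity**: after the substitution `midTranslate Y`, the integrand is the
doubled integrand: `midIntegrand (midTranslate Y U) = R(U, Y)`. -/
theorem midIntegrand_midTranslate (hρ : Continuous ρ) {β : ℝ} (hβ : 0 ≤ β) {F : Config A d G → ℂ}
    (hFo : IsMidObservable e Q h F) (U Y : Config A d G) :
    midIntegrand ρ e k σ β F (midTranslate k Q h Y U) = midIntegrand₂ ρ e k σ Q h hρ β F (U, Y) := by
  have hPC : ∀ l : Link A d, IsMidPosLink e Q h l → ¬ IsMidCrossLink k Q h l :=
    fun l hl hc => hF.not_isMidPosLink_of_isMidCrossLink hc hl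
  have htr : ∀ l, IsMidPosLink e Q h l → midTranslate k Q h Y U l = U l :=
    fun l hl => midTranslate_apply_of_not_isMidCrossLink Y U (hPC l hl)
  have hsp : ∀ l, IsMidPosLink e Q h l → LatticeRP.splice (midCrossBlock k Q h) (U, Y) l = U l :=
    fun l hl => splice_apply_of_not_isMidCrossLink U Y (hPC l hl)
  have hΘtr : ∀ l, IsMidPosLink e Q h l →
      configMidReflect e k σ (midTranslate k Q h Y U) l = configMidReflect e k σ U l := by
    intro l hl
    simp only [configMidReflect,
      midTranslate_apply_of_not_isMidCrossLink Y U (hF.not_isMidCrossLink_midLinkMap hl)]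
  have hF1 : F (midTranslate k Q h Y U) = F U := hFo _ _ htr
  have hF2 : F (configMidReflect e k σ (midTranslate k Q h Y U)) = F (configMidReflect e k σ U) :=
    hFo _ _ hΘtr
  have hF3 : F (LatticeRP.splice (midCrossBlock k Q h) (U, Y)) = F U := hFo _ _ hsp
  have hA1 := hF.sum_pos_congr ρ htr
  have hA2 := hF.sum_pos_congr ρ hΘtr
  have hA3 := hF.sum_pos_congr ρ hsp
  unfold midIntegrand₂
  rw [hF.sum_midCoeff_mul_conj ρ hρ hβ, midIntegrand, wilsonAction_eq,
    hF.sum_plaqObs_split_mid ρ hρ (midTranslate k Q h Y U), hF1, hF2, hA1, hA2, midGObs, midGObs,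
    hF3, hA3, ← Complex.ofReal_exp]
  set A1 := ∑ p ∈ Finset.univ.filter (IsMidPosPlaq k Q h), plaqObs ρ e p U
  set A2 := ∑ p ∈ Finset.univ.filter (IsMidPosPlaq k Q h), plaqObs ρ e p (configMidReflect e k σ U)
  set X := ∑ p ∈ Finset.univ.filter (IsMidCrossPlaq k Q h), plaqObs ρ e p (midTranslate k Q h Y U)
  simp only [map_mul, Complex.conj_ofReal]
  rw [show -β * (↑N * ↑(Fintype.card (Plaq A d)) - (A1 + A2 + X)) =
      -β * (↑N * ↑(Fintype.card (Plaq A d))) + β * A1 + β * A2 + β * X by ring,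
    Real.exp_add, Real.exp_add, Real.exp_add]
  push_cast
  ring

omit [CompactSpace G] hF in
/-- The integrand is measurable. -/
theorem measurable_midIntegrand (hρ : Continuous ρ) (β : ℝ) {F : Config A d G → ℂ}
    (hFm : Measurable F) : Measurable (midIntegrand ρ e k σ β F) :=
  (Complex.measurable_ofReal.comp
    ((continuous_const.mul (continuous_wilsonAction ρ hρ e)).measurable.exp)).mul
    ((Complex.continuous_conj.measurable.comp (hFm.comp measurable_configMidReflect)).mul hFm)

open scoped Classical in
omit hF in
/-- The doubled integrand is measurable. -/
theorem measurable_midIntegrand₂ (hρ : Continuous ρ) (β : ℝ) {F : Config A d G → ℂ}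
    (hFm : Measurable F) : Measurable (midIntegrand₂ ρ e k σ Q h hρ β F) := by
  have hg := measurable_midGObs ρ (e := e) (k := k) (Q := Q) (h := h) hρ β hFm
  have hconj : Measurable (starRingEnd ℂ : ℂ → ℂ) := Complex.continuous_conj.measurable
  have hsp : Measurable (LatticeRP.splice (midCrossBlock k Q h) :
      Config A d G × Config A d G → Config A d G) := LatticeRP.measurable_splice _
  have hΘ1 : Measurable fun p : Config A d G × Config A d G => configMidReflect e k σ p.1 :=
    measurable_configMidReflect.comp measurable_fst
  refine measurable_const.mul (((hg.comp hsp).mul (hconj.comp (hg.comp hΘ1))).mul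
    (Complex.measurable_exp.comp (Finset.measurable_sum _ fun ι _ => ?_)))
  exact ((measurable_midCoeff ρ hρ β ι).comp hsp).mul
    (hconj.comp ((measurable_midCoeff ρ hρ β ι).comp hΘ1))

open scoped Classical in
omit [MeasurableSpace G] [BorelSpace G] [SecondCountableTopology G] hF in
/-- The doubled integrand is bounded. -/
theorem norm_midIntegrand₂_le (hρ : Continuous ρ) {β : ℝ} (hβ : 0 ≤ β) {F : Config A d G → ℂ}
    {CF : ℝ} (hFb : ∀ U, ‖F U‖ ≤ CF) (p : Config A d G × Config A d G) :
    ‖midIntegrand₂ ρ e k σ Q h hρ β F p‖ ≤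
      Real.exp (-β * (N * Fintype.card (Plaq A d))) *
        ((|CF| * Real.exp (β * (N * Fintype.card (Plaq A d)))) *
          (|CF| * Real.exp (β * (N * Fintype.card (Plaq A d)))) *
          Real.exp (Fintype.card (Plaq A d × Fin N × Fin N × Bool) *
            (Real.sqrt (β / 2) * Real.sqrt (β / 2)))) := by
  unfold midIntegrand₂
  rw [norm_mul, Complex.norm_real, Real.norm_eq_abs, abs_of_pos (Real.exp_pos _)]
  refine mul_le_mul_of_nonneg_left ?_ (Real.exp_pos _).le
  rw [norm_mul, norm_mul, Complex.norm_conj]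
  refine mul_le_mul (mul_le_mul (norm_midGObs_le ρ hρ hβ hFb _) (norm_midGObs_le ρ hρ hβ hFb _)
    (norm_nonneg _) (by positivity)) ?_ (norm_nonneg _) (by positivity)
  rw [Complex.norm_exp]
  refine Real.exp_le_exp.2 ((Complex.re_le_norm _).trans ?_)
  calc ‖∑ ι, midCoeff ρ e k Q h hρ β ι (LatticeRP.splice (midCrossBlock k Q h) p) *
          conj (midCoeff ρ e k Q h hρ β ι (configMidReflect e k σ p.1))‖
      ≤ ∑ ι, ‖midCoeff ρ e k Q h hρ β ι (LatticeRP.splice (midCrossBlock k Q h) p) *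
          conj (midCoeff ρ e k Q h hρ β ι (configMidReflect e k σ p.1))‖ := norm_sum_le _ _
    _ ≤ ∑ _ι : Plaq A d × Fin N × Fin N × Bool, Real.sqrt (β / 2) * Real.sqrt (β / 2) :=
        Finset.sum_le_sum fun ι _ => by
          rw [norm_mul, Complex.norm_conj]
          exact mul_le_mul (norm_midCoeff_le ρ hρ β ι _) (norm_midCoeff_le ρ hρ β ι _)
            (norm_nonneg _) (Real.sqrt_nonneg _)
    _ = Fintype.card (Plaq A d × Fin N × Fin N × Bool) * (Real.sqrt (β / 2) * Real.sqrt (β / 2)) := by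
        rw [Finset.sum_const, Finset.card_univ, nsmul_eq_mul]

/-! ## Reflection positivity -/

open scoped Classical in
/-- **Reflection positivity of the Boltzmann weight** (`β ≥ 0`, `F` bounded measurable on the
closed half): `0 ≤ ∫ e^{-β S(U)} conj F(ΘU) F(U) ∏ dU`. -/
theorem integral_midIntegrand_nonneg (hρ : Continuous ρ) {β : ℝ} (hβ : 0 ≤ β)
    {F : Config A d G → ℂ} (hFm : Measurable F) {CF : ℝ} (hFb : ∀ U, ‖F U‖ ≤ CF)
    (hFo : IsMidObservable e Q h F) :
    0 ≤ ∫ U, midIntegrand ρ e k σ β F U ∂(productHaar A d G) := by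
  haveI : IsProbabilityMeasure (haarProbability G) :=
    CompactGroup.isProbabilityMeasure_haarMeasure_top
  haveI := isProbabilityMeasure_productHaar (A := A) (d := d) (G := G)
  set μ : Measure (Config A d G) := productHaar A d G with hμ
  have hHm : Measurable (midIntegrand ρ e k σ β F) := measurable_midIntegrand ρ hρ β hFm
  have hR : ∀ U Y, midIntegrand ρ e k σ β F (midTranslate k Q h Y U) =
      midIntegrand₂ ρ e k σ Q h hρ β F (U, Y) :=
    fun U Y => hF.midIntegrand_midTranslate ρ hρ hβ hFo U Y
  have hRi : Integrable (midIntegrand₂ ρ e k σ Q h hρ β F) (μ.prod μ) :=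
    Integrable.of_bound (measurable_midIntegrand₂ ρ hρ β hFm).aestronglyMeasurable _
      (ae_of_all _ (norm_midIntegrand₂_le ρ hρ hβ hFb))
  have step1 : ∫ U, midIntegrand ρ e k σ β F U ∂μ =
      ∫ Y, ∫ U, midIntegrand₂ ρ e k σ Q h hρ β F (U, Y) ∂μ ∂μ := by
    have hY : ∀ Y, ∫ U, midIntegrand ρ e k σ β F U ∂μ =
        ∫ U, midIntegrand₂ ρ e k σ Q h hρ β F (U, Y) ∂μ := fun Y => by
      rw [← LatticeRP.integral_comp_eq_of_measurePreserving (measurePreserving_midTranslate Y) hHm]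
      exact integral_congr_ae (ae_of_all _ fun U => hR U Y)
    calc ∫ U, midIntegrand ρ e k σ β F U ∂μ = ∫ _Y, (∫ U, midIntegrand ρ e k σ β F U ∂μ) ∂μ := by
          rw [integral_const, probReal_univ, one_smul]
      _ = ∫ Y, ∫ U, midIntegrand₂ ρ e k σ Q h hρ β F (U, Y) ∂μ ∂μ :=
          integral_congr_ae (ae_of_all _ hY)
  rw [step1, ← integral_prod_symm _ hRi]
  unfold midIntegrand₂
  rw [integral_const_mul]
  refine mul_nonneg (Complex.zero_le_real.2 (Real.exp_pos _).le) ?_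
  have key := LatticeRP.integral_mul_conj_mul_exp_nonneg (haarProbability G) (midPosBlock e Q h)
    (midCrossBlock k Q h) (configMidReflect e k σ) hF.measurePreserving_configMidReflect
    (fun l hl => hF.dependsOn_configMidReflect_apply l hl)
    (g := midGObs ρ e k Q h β F) (a := fun ι V => midCoeff ρ e k Q h hρ β ι V)
    (measurable_midGObs ρ hρ β hFm) (fun ι => measurable_midCoeff ρ hρ β ι)
    (norm_midGObs_le ρ hρ hβ hFb) (fun ι V => norm_midCoeff_le ρ hρ β ι V)
    (fun U V hUV => hF.midGObs_congr ρ β hFo (eq_on_of_eq_on_midBlocks hUV))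
    (fun ι U V hUV => hF.midCoeff_congr ρ hρ β ι (eq_on_of_eq_on_midBlocks hUV))
  unfold productHaar at hμ
  rw [hμ]
  exact key

/-- **Mid-plane (link) reflection positivity of the Wilson measure of a periodic lattice with a
site frame** (Osterwalder–Seiler): for a compact second countable `G`, continuous `ρ`, `β ≥ 0` and
every bounded measurable observable `F` of the closed half `{1 ≤ h ≤ Q}`,
`0 ≤ ∫ conj F(ΘU) F(U) dμ_β(U)`, `Θ` the reflection in the hyperplane `h = ½`. -/
theorem linkRP_integral_conj_mul_nonneg (hρ : Continuous ρ) {β : ℝ} (hβ : 0 ≤ β)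
    (F : Config A d G → ℂ) (hFm : Measurable F) (hFb : ∃ C : ℝ, ∀ U, ‖F U‖ ≤ C)
    (hFo : IsMidObservable e Q h F) :
    0 ≤ ∫ U, conj (F (configMidReflect e k σ U)) * F U ∂(gibbs ρ e β) := by
  classical
  obtain ⟨CF, hFb⟩ := hFb
  have hZ := normaliser_pos (A := A) (G := G) ρ hρ e β
  rw [integral_gibbs]
  simp_rw [Complex.real_smul, Complex.ofReal_div, div_eq_mul_inv, mul_comm (Complex.ofReal _)
    ((_ : ℂ)⁻¹), mul_assoc]
  rw [integral_const_mul]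
  refine mul_nonneg ?_ (hF.integral_midIntegrand_nonneg ρ hρ hβ hFm hFb hFo)
  rw [← Complex.ofReal_inv]
  exact Complex.zero_le_real.2 (inv_nonneg.2 hZ.le)

/-- **The link RP blocks are positive semidefinite**: for bounded measurable half-space observables
`F_1, …, F_n` and `c ∈ ℂ^n`, `0 ≤ ∑_{a,b} conj c_a · c_b · ∫ conj(F_a(ΘU)) F_b(U) dμ_β`. -/
theorem linkRP_sum_mul_conj_integral_nonneg (hρ : Continuous ρ) {β : ℝ} (hβ : 0 ≤ β) {n : ℕ}
    (F : Fin n → Config A d G → ℂ) (hFm : ∀ a, Measurable (F a))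
    (hFb : ∀ a, ∃ C : ℝ, ∀ U, ‖F a U‖ ≤ C) (hFo : ∀ a, IsMidObservable e Q h (F a)) (c : Fin n → ℂ) :
    0 ≤ ∑ a, ∑ b, conj (c a) * c b *
      ∫ U, conj (F a (configMidReflect e k σ U)) * F b U ∂(gibbs ρ e β) := by
  haveI := isProbabilityMeasure_gibbs (A := A) (G := G) ρ hρ e β
  set H : Config A d G → ℂ := fun U => ∑ b, c b * F b U with hH
  have hHm : Measurable H := Finset.measurable_sum _ fun b _ => (hFm b).const_mul _
  choose C hC using hFb
  have hHb : ∃ K : ℝ, ∀ U, ‖H U‖ ≤ K := ⟨∑ b, ‖c b‖ * C b, fun U =>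
    (norm_sum_le _ _).trans (Finset.sum_le_sum fun b _ => by
      rw [norm_mul]; exact mul_le_mul_of_nonneg_left (hC b U) (norm_nonneg _))⟩
  have hHo : IsMidObservable e Q h H := fun U V hUV => by
    simp only [hH]
    exact Finset.sum_congr rfl fun b _ => by rw [hFo b U V hUV]
  have key := hF.linkRP_integral_conj_mul_nonneg ρ hρ hβ H hHm hHb hHo
  have hint : ∀ a b, Integrable (fun U => conj (F a (configMidReflect e k σ U)) * F b U)
      (gibbs ρ e β) :=
    fun a b => Integrable.of_bound
      (((Complex.continuous_conj.measurable.comp ((hFm a).comp measurable_configMidReflect)).mul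
        (hFm b)).aestronglyMeasurable) (C a * C b) (ae_of_all _ fun U => by
        rw [norm_mul, Complex.norm_conj]
        exact mul_le_mul (hC a _) (hC b U) (norm_nonneg _) ((norm_nonneg (F a U)).trans (hC a U)))
  have hexp : ∫ U, conj (H (configMidReflect e k σ U)) * H U ∂(gibbs ρ e β) =
      ∑ a, ∑ b, conj (c a) * c b *
        ∫ U, conj (F a (configMidReflect e k σ U)) * F b U ∂(gibbs ρ e β) := by
    have h1 : ∀ U, conj (H (configMidReflect e k σ U)) * H U =
        ∑ a, ∑ b, conj (c a) * c b * (conj (F a (configMidReflect e k σ U)) * F b U) := fun U => by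
      simp only [hH, map_sum, map_mul]
      rw [Finset.sum_mul_sum]
      exact Finset.sum_congr rfl fun a _ => Finset.sum_congr rfl fun b _ => by ring
    simp_rw [h1]
    rw [integral_finsetSum _ fun a _ => integrable_finsetSum _ fun b _ => (hint a b).const_mul _]
    refine Finset.sum_congr rfl fun a _ => ?_
    rw [integral_finsetSum _ fun b _ => (hint a b).const_mul _]
    exact Finset.sum_congr rfl fun b _ => integral_const_mul _ _
  rwa [hexp] at key

/-- **Reflection invariance of the Wilson measure**: `∫ F(ΘU) dμ_β = ∫ F dμ_β` (measurable real `F`,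
every real `β`). -/
theorem integral_comp_configMidReflect_gibbs (hρ : Continuous ρ) (β : ℝ) {F : Config A d G → ℝ}
    (hFm : Measurable F) :
    ∫ U, F (configMidReflect e k σ U) ∂(gibbs ρ e β) = ∫ U, F U ∂(gibbs ρ e β) := by
  rw [integral_gibbs, integral_gibbs]
  set Z := ∫ U, Real.exp (-β * wilsonAction ρ e U) ∂(productHaar A d G)
  have h1 : ∀ U : Config A d G,
      (Real.exp (-β * wilsonAction ρ e U) / Z) • F (configMidReflect e k σ U) =
        (fun V : Config A d G => (Real.exp (-β * wilsonAction ρ e V) / Z) • F V)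
          (configMidReflect e k σ U) := by
    intro U
    simp only [hF.wilsonAction_configMidReflect ρ hρ]
  have hm : Measurable fun V : Config A d G => (Real.exp (-β * wilsonAction ρ e V) / Z) • F V :=
    (((continuous_boltzmann ρ hρ e β).measurable).div_const _).smul hFm
  simp_rw [h1]
  rw [← integral_map hF.measurePreserving_configMidReflect.measurable.aemeasurable
    hm.aestronglyMeasurable, hF.measurePreserving_configMidReflect.map_eq]

end IsSiteFrame

end TiltedRP

end Summit.QuantumFields.GaugeBoot
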